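import Summits.ABC.IUTFork.DAGC312r
import Summits.ABC.IUTFork.Cor312IdentifiedNonVacuityThm311

/-!
# Kernel DAG index — layer C312, part t: knitting DELTA 11 — NON-VACUITY of the apex hypotheses of parts p/q/r (the cell's standing
vacuity audit, LANA Rem. 8.2.1 / skel `ForkChecks` style), BY NAME from the landed toy situations

index v1 · abc-iut-c312-2 (filer, gen 3). PROOF-ONLY, APPEND-ONLY (imports part r). Part p's apex `summit_of_cor312_M_xi_f` rests, per curve, on
{`ThetaFinite`, `AbsLogQPos`, THE NODE `N_IUTchIII_Cor3_12_pf_xi_f` at the readings of record}. This part records, over FULL situations in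
which THEOREM 3.11 AS TYPED HOLDS, that this hypothesis set is

* JOINTLY SATISFIABLE — Team R's non-vacuity instance (abc-iut-c312-14 lineage, `Cor312.IdentifiedNonVacuity.nvFull` / `nvSetting`,
  `Cor312IdentifiedNonVacuityThm311`: typed Thm 3.11 (i)∧(ii)∧(iii), all bridge hypotheses, `|log(q)| > 0`, non-degenerate regions, and the
  typed Statement TRUE): there the (xi-f) node HOLDS for every `pending` (`xi_f_hyps_satisfiable`);
* NOT AUTOMATIC — Team A's gap witness (abc-iut-c312-9, `Cor312Vol.GapWitness.gapFull` / `gapSetting`, `Cor312TeamAGapWitnessB`: typed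
  Thm 3.11, all bridge hypotheses, `ThetaFinite`, `|log(q)| > 0`, typed Statement FALSE): there the (xi-f) node FAILS for every `pending`
  (`xi_f_not_automatic`);
hence `xi_f_node_undecided_by_typed_thm311`: Theorem 3.11 as typed together with the Statement's own side clauses decides the one remaining
node NEITHER way — the index-currency form of the cell's pair `GapWitness.thm311_bridgeHyps_not_imp_statement` /
`IdentifiedNonVacuity.thm311_decides_neither`. Strips data: both toys have `Unit`-typed strips, so the (xi-a)/(xi-b) datum `D` is the constant
one. THIS FILE PROVES NOTHING NEW about [IUTchIII] §3 AND ASSERTS NOTHING; no side taken on Cor. 3.12. typed ≠ discharged; indexed ≠ endorsed.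
[claim: Mochizuki2012, status: disputed]
-/

noncomputable section

namespace Summit.ABC.IUTFork.DAG

open Cor312Proof Thm311 Cor312Vol Cor312Vol.GapWitness Cor312.IdentifiedNonVacuity Literature.IUT.LogThetaLattice

/-- **SATISFIABLE**: a full situation with Theorem 3.11 as typed TRUE, `ThetaFinite`, `AbsLogQPos`, and the (xi-f) node under the readings of
record TRUE for every `pending` (Team R's non-vacuity instance; the typed Statement holds there). [folklore] -/
theorem xi_f_hyps_satisfiable :
    ∃ (T : ThetaIndex) (S : FullSituation T) (P : Cor312.Setting S.toSituation) (D : ThetaLinkStrips P.LogLink P.Strip),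
      S.Statement ∧ P.ThetaFinite ∧ P.AbsLogQPos ∧
        ∀ pending : Locus → Prop, N_IUTchIII_Cor3_12_pf_xi_f (lociReadingI S pending) (obsReadingA S pending P D) :=
  ⟨Cor312.Checks.toyIndex, nvFull, nvSetting, ⟨fun _ => (), fun _ => (), fun _ => ()⟩, nvFull_statement, nvSetting_bridgeHyps.finite,
    nvSetting_absLogQPos, fun pending =>
      N_IUTchIII_Cor3_12_pf_xi_f_holds_of_statement nvFull pending nvSetting _ nvSetting_statement⟩

/-- **NOT AUTOMATIC**: a full situation with Theorem 3.11 as typed TRUE, `ThetaFinite`, `AbsLogQPos`, and the (xi-f) node under the readings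
of record FALSE for every `pending` (Team A's gap witness; the typed Statement fails there). [folklore] -/
theorem xi_f_not_automatic :
    ∃ (T : ThetaIndex) (S : FullSituation T) (P : Cor312.Setting S.toSituation) (D : ThetaLinkStrips P.LogLink P.Strip),
      S.Statement ∧ P.ThetaFinite ∧ P.AbsLogQPos ∧
        ∀ pending : Locus → Prop, ¬ N_IUTchIII_Cor3_12_pf_xi_f (lociReadingI S pending) (obsReadingA S pending P D) :=
  ⟨Cor312.Checks.toyIndex, gapFull, gapSetting, ⟨fun _ => (), fun _ => (), fun _ => ()⟩, gapFull_statement, gap_thetaFinite,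
    gapSetting_absLogQPos, fun pending h =>
      gapSetting_not_statement
        ((N_IUTchIII_Cor3_12_pf_xi_f_iff_statement gapFull pending gapSetting _ gap_thetaFinite gapSetting_absLogQPos).1 h)⟩

/-- **Theorem 3.11 as typed, with the Statement's own side clauses, decides the one remaining node NEITHER way** (both instances above, side
by side). Interface level; says nothing about the intended model. [folklore] -/
theorem xi_f_node_undecided_by_typed_thm311 :
    (∃ (T : ThetaIndex) (S : FullSituation T) (P : Cor312.Setting S.toSituation) (D : ThetaLinkStrips P.LogLink P.Strip),
      S.Statement ∧ P.ThetaFinite ∧ P.AbsLogQPos ∧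
        ∀ pending : Locus → Prop, N_IUTchIII_Cor3_12_pf_xi_f (lociReadingI S pending) (obsReadingA S pending P D)) ∧
    (∃ (T : ThetaIndex) (S : FullSituation T) (P : Cor312.Setting S.toSituation) (D : ThetaLinkStrips P.LogLink P.Strip),
      S.Statement ∧ P.ThetaFinite ∧ P.AbsLogQPos ∧
        ∀ pending : Locus → Prop, ¬ N_IUTchIII_Cor3_12_pf_xi_f (lociReadingI S pending) (obsReadingA S pending P D)) :=
  ⟨xi_f_hyps_satisfiable, xi_f_not_automatic⟩

end Summit.ABC.IUTFork.DAG

end
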